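import Summits.CriticalPhenomena.PercolationContinuityZ3.Theorems.PercNearOneGluingNoHeavyLowerTailFKCSHPhiDefs
import Summits.CriticalPhenomena.PercolationContinuityZ3.Theorems.PercNearOneGluingNoHeavyLowerTailFKHullPortTADefs
import HarnessLib

/-!
# FK sub-lane: the residual functional `Φ_FK` of the unfolding for `φ_{w,q}` at MASS level (definitions)

Definitions file (`--supports stmt-CriticalPhenomena-4575`), FK sub-lane `prim-bschramm-fk-2` (gen 4) of the post-continuity
programme; builds on p205010 (kernel theorem, internal audit signed; external expert review pending).  No theorems, no named facts,
no sorries.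

These are the sum-level objects of fk-2 gen 4's proof of Lemma Φ(b) for the random-cluster measure (`FK.PhiFKMonotone q`,
`…FKCSHPhiDefs.lean`, the last located statement of the FK finite leg; bschramm/FK-Q2.md §13), in the bookkeeping of gen 3's
hull-port files (`…FKHullPortTADefs.lean`): weight vector `w` on one vertex type, deletion of the vertex set `K` = the pairs meeting
`K` given parameter `0` (`delW w (CSH.edgesOf K)`), contraction of a pair = parameter `1`, worlds `FK.wE`.
* `FK.phiD w q x Y g ω = 1{x ↮ Y}(ω)·( E_{φ_{w − cut_Y(ω), q}}[g(C_x)] − g(C_x(ω)) )` — the integrand of `FK.phiFK` (world mean of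
  Lemma T_rc computed in `G`, minus the own value), as a function of the configuration; it does NOT depend on `K`, and it does
  not see the parameter of any pair meeting the open vertex cluster of `Y`;
* `FK.phiMass w q x Y g K = Σ_ω w_q^{G−K̄}(ω)·phiD(ω)` — the unnormalised mass (`w_q^{G−K̄} = rcWeightW (delW w (edgesOf K)) q ∅`);
* `FK.zMass w q K = Z_{G−K̄}` — the partition function of the deleted graph;
so that `FK.phiFK w q x Y g K = phiMass / zMass` (`…FKPhiMassBridge.lean`).  Both masses are AFFINE in the parameter of every pair
meeting `Y` — the second Bernstein deformation AT `Y` (bschramm/FK-Q2.md §13).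
[cite: VandenbergHaggstromKahn2005, §2.1 eq. (11), Lemmas 2.3–2.4 (p. 10)] [cite: Grimmett2006, §1.4 eq. (1.20) (p. 15); Thm. (3.1)(a) (p. 37)]
-/

noncomputable section

namespace Summit.CriticalPhenomena.PercolationContinuityZ3.Theorems.FK

open MeasureTheory Set Literature.Probability.LatticeModels Literature.Probability.Percolation
open Literature.Probability.Percolation.DecisionTree (ind)
open Literature.Probability.Percolation.BHK2006 (rcMass delW)
open Summit.CriticalPhenomena.PercolationContinuityZ3.Theorems.HullPort (cut avoidEv)
open scoped Classical

variable {V : Type*} [Fintype V]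

/-- **The integrand of `Φ_FK`**: `phiD(ω) = 1{x ↮ Y}(ω) · ( E_{φ_{w − cut_Y(ω), q}}[g(C_x)] − g(C_x(ω)) )` — the world mean of
`g(C_x)` in `G` with the pairs meeting the open vertex cluster of `Y` deleted (van den Berg–Häggström–Kahn's Lemma 2.3 world, same `q`)
minus the own value, on `{x ↮ Y}`.  Independent of the deleted set `K` and of the parameters of the pairs meeting `C_Y(ω)`.
(transcription of the cell memo prim-hp-8 PROOF-S5-ALL-R.md §3.2, FK-parametrised) [cite: VandenbergHaggstromKahn2005, §2.1 Lemma 2.3 (p. 10)] -/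
def phiD (w : Sym2 V → unitInterval) (q : ℝ) (x : V) (Y : Set V) (g : Set (Sym2 V) → ℝ) (ω : Set (Sym2 V)) : ℝ :=
  ind (avoidEv x Y) ω * (wE w q (cut Y ω) (fun η => g (openEdgeCluster η x)) - g (openEdgeCluster ω x))

/-- **The unnormalised mass of `Φ_FK(K)`**: `phiMass = Σ_ω w_q^{G−K̄}(ω) · phiD(ω)` with the free random-cluster weight of the graph
with the pairs meeting `K` deleted, `w_q^{G−K̄} = rcWeightW (delW w (edgesOf K)) q ∅`; `Φ_FK(K) = phiMass / zMass`.
[cite: Grimmett2006, §1.4 eq. (1.20) (p. 15)] [cite: VandenbergHaggstromKahn2005, §2.1 eq. (11) (p. 9)] -/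
def phiMass (w : Sym2 V → unitInterval) (q : ℝ) (x : V) (Y : Set V) (g : Set (Sym2 V) → ℝ) (K : Set V) : ℝ :=
  ∑ ω, rcWeightW (delW w (CSH.edgesOf K)) q ∅ ω * phiD w q x Y g ω

/-- **The partition function of the deleted graph `G − K̄`**: `zMass = Z_{w − K̄, q} = Σ_ω w_q^{G−K̄}(ω)`.
[cite: Grimmett2006, §1.4 eq. (1.20) (p. 15)] -/
def zMass (w : Sym2 V → unitInterval) (q : ℝ) (K : Set V) : ℝ :=
  rcPartitionFunctionW (delW w (CSH.edgesOf K)) q ∅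

end Summit.CriticalPhenomena.PercolationContinuityZ3.Theorems.FK

end
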